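import Summits.Ventures.PercRepro.SquarePos13Part3

/-!
# The square lemma, case analysis at position 13 (generated)

Dossier proofs/MINE1-theoremS.md, Addendum 82 (mine-1, gen 43). Generated by the lane's
`gen_square.py` from the P-uniform proof tree of `sqlazy2.c` for the position
`r ∈ b, r ∉ a, q ∈ b', q ∈ a'`: Boolean cores by `decide` (`sqb_*`), then the
rules of `ThetaOmegaCoreSquareRules.lean`; case analysis, level 3, module 4 of 5.
-/

namespace PercRepro.MSTight

open Finset

variable {α : Type*} [DecidableEq α] {U : Finset α} {F : Finset (Finset α)}
  {c0 c1 : Finset α → Bool} {q r : α} {b a b' a' : Finset α}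

/-- A branch of the square lemma's case analysis at position 13 (generated). -/
theorem sq_13_k0
    (H : SqCtx U F c0 c1 q r b a b' a') (hrb : r ∈ b) (hra : r ∉ a) (hqb' : q ∈ b')
    (hqa' : q ∈ a') (hδ : c1 b = false) (hε : c1 b' = false) (hKb : c0 (insert q b) = c1 b)
    (hKa : c0 (insert q a) = c1 a) (hKb' : c0 (insert r b') = c1 b')
    (hKa' : c0 (insert r a') = c1 a') :
    False := by
  by_cases hE02_s1 : ∀ z, z ≠ q → z ≠ r → (z ∈ b ↔ z ∈ b')
  · have heq51_r1 : insert r b' = insert q b := by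
      refine ext_of_pattern q r ?_ ?_ ?_
      · have _fb := H.hqb
        have _fbp := hqb'
        have _fne : ¬ q = r := H.hqr
        have _frfl : q = q := rfl
        clear * - _fb _fbp _fne _frfl
        simp only [mem_insert]
        all_goals tauto
      · have _fb := hrb
        have _fbp := H.hrb'
        have _fne : ¬ r = q := Ne.symm H.hqr
        have _frfl : r = r := rfl
        clear * - _fb _fbp _fne _frfl
        simp only [mem_insert]
        all_goals tauto
      intro z _hzq _hzr
      have _e1 := hE02_s1 z _hzq _hzr
      clear * - _hzq _hzr _e1
      simp only [mem_insert]
      by_cases _p1 : z ∈ b <;> by_cases _p2 : z ∈ a <;> by_cases _p3 : z ∈ b' <;> by_cases _p4 : z ∈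
          a' <;> simp_all
    exact sq_13_1 H hrb hra hqb' hqa' hδ hε hKb hKa hKb' hKa' hE02_s1 heq51_r1
  · have hN02_s8 : ∃ z, z ≠ q ∧ z ≠ r ∧ ¬ (z ∈ b ↔ z ∈ b') := by
      by_contra hcon
      apply hE02_s1
      intro z hzq hzr
      by_contra hz
      exact hcon ⟨z, hzq, hzr, hz⟩
    exact sq_13_3 H hrb hra hqb' hqa' hδ hε hKb hKa hKb' hKa' hN02_s8

end PercRepro.MSTight
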